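import Mathlib
import Summits.CriticalPhenomena.CardyFormulaZ2.Theses.CardyFlipRusso
import Summits.CriticalPhenomena.CardyFormulaZ2.Theorems.CardyFlipRussoSquareFromVoronoiHubDefs
import Summits.CriticalPhenomena.CardyFormulaZ2.Theorems.CardyFlipRussoSquareFromVoronoiHubDilutionDefs
import Summits.CriticalPhenomena.CardyFormulaZ2.Theorems.CardyFlipRussoSquareFromVoronoiHubDilutionHypothesisEnd
import Summits.CriticalPhenomena.CardyFormulaZ2.Theorems.CardyFlipRussoSquareFromVoronoiHubDilutionLatticeLaw
import Summits.CriticalPhenomena.CardyFormulaZ2.Theorems.CardyFlipRussoSquareFromVoronoiHubDilutionLatticeDictionary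
import Summits.CriticalPhenomena.CardyFormulaZ2.Theorems.CardyFlipRussoSquareFromVoronoiHubDilutionLatticeChain
import Summits.CriticalPhenomena.CardyFormulaZ2.Theorems.CardyFlipRussoSquareFromVoronoiHubDilutionGsConfigLaw
import Summits.CriticalPhenomena.CardyFormulaZ2.Theorems.CardyFlipRussoSquareFromVoronoiHubDilutionLatticeNoTouch
import Summits.CriticalPhenomena.CardyFormulaZ2.Theorems.CardyFlipRussoSquareFromVoronoiHubDilutionLatticeEndPart1
import Summits.CriticalPhenomena.CardyFormulaZ2.Theorems.CardyFlipRussoSquareFromVoronoiHubDilutionLatticeEnd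
import Literature.Probability.Percolation.VoronoiCrossing
import Literature.Analysis.FunctionSpaces.PoissonPointProcess
import HarnessLib

/-!
# Assembly of the line `poisson-dilution-leg` for crux `SquareFromVoronoiHub`
# (stmt-CriticalPhenomena-6434, route `CardyFlipRusso`, sub-problem `CardyFormulaZ2`; lead c5, 2026-08-17)

THE REDUCTION THEOREM of the line, kernel-checked: the crux
`CardyFlipRusso.SquareFromVoronoiHub` ("Cardy's formula for annealed two-colour Poisson–Voronoi percolation
implies Cardy's formula for site percolation at `1/2` on the centred square lattice `G_s`") FOLLOWS from ONE
statement, LEG CONSTANCY along the Poisson-dilution leg of `…DilutionDefs` — annealed crossing probabilities are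
asymptotically constant in the dilution parameter `t ∈ [0,1]`, uniformly, for Poisson pairs of intensity
`t · volume` (`squareFromVoronoiHub_of_dilutionLegConstancy`, registered as `stub_dilutionAssembly`).  Both ENDS
of the leg are theorems of the tree and are assembled here by name:

* `stub_dilutionHypothesisEnd` (`…DilutionHypothesisEnd`, used by name): at `t = 1` the lattice is almost
  surely empty and hubs almost surely absent, so the leg probability IS the hypothesis probability
  `voronoiCrossingProb`;
* `latticeEnd_holds` (from `stub_latticeEnd_of` fed with `stub_latticeLaw`, `stub_latticeDictionary`,
  `stub_latticeChain`, `stub_gsConfigLaw`, `stub_latticeNoTouch`; modules `…DilutionLattice*`,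
  `…DilutionGsConfigLaw`, `…DilutionLatticeEnd(Part1)`): at `t = 0` the leg is site percolation on `G_s` read as
  unit cells and hub points, and Cardy for its continuum crossing event gives Cardy for the crux's crude
  `2δ`-slack event (sandwich between K1's perturbed conformal rectangles).

Leg constancy itself is NOT claimed: it is crossing universality along a one-parameter family of critical,
positively associated, `D₄`-symmetric, exactly self-matching planar models (an instance of Bálint–Camia–Meester,
arXiv:0708.3349, Conjecture 1.9; the route's kernel stmt-CriticalPhenomena-7029 in leg form) and enters only as
the hypothesis of the reduction theorem.

Sources: the strategist's census `Cruxes/SquareFromVoronoiHub/STRATEGY-CENSUS.md` §6 and line card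
`Lines/poisson_dilution_leg.md`; Benjamini–Schramm, Comm. Math. Phys. 197 (1998) §1; Bollobás–Riordan,
*Percolation* (2006), Ch. 7 Lemma 14 and Ch. 8 §§8.1–8.3.
-/

noncomputable section

open scoped Topology
open MeasureTheory Metric Set Filter
open Literature.Analysis.FunctionSpaces (PointConfig IsPoissonPointProcess
  existsUnique_isPoissonPointProcess_holds)
open Literature.Probability.Percolation (SiteConfig sitePercolation half blackRegion voronoiCrossing)
open Literature.Probability.RandomPlanarGeometry (ConformalRectangle cardyFunction crossRatio)
open Summit.CriticalPhenomena.CardyFormulaZ2.Cruxes.SquareFromVoronoiHub.VoronoiBlocks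
  (zGs Gs crudeCrossing siteCrossingProb voronoiCrossingProb squareFromVoronoiHub_iff)

namespace Summit.CriticalPhenomena.CardyFormulaZ2.Cruxes.SquareFromVoronoiHub.PoissonDilutionLeg

/-- **The lattice end of the Poisson-dilution leg holds**: Cardy's formula for the `t = 0` leg probabilities of
every conformal rectangle (Poisson pair of intensity zero) implies Cardy's formula for the crude site crossing of
`G_s` — the landed assembly `stub_latticeEnd_of` fed with the landed law reduction, dictionary, chain lemma,
`G_s` law and no-touch lemma. [cite: BollobasRiordan2006, Ch. 7 Lemma 14 with (19)] -/
theorem latticeEnd_holds :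
    (∀ (PB PW : Measure (PointConfig ℂ)),
        IsPoissonPointProcess (0 : Measure ℂ) PB → IsPoissonPointProcess (0 : Measure ℂ) PW →
        ∀ R : ConformalRectangle, R.HasCrossingLimit (legProb 0 PB PW R) cardyFunction) →
      ∀ R : ConformalRectangle, R.HasCrossingLimit (siteCrossingProb R) cardyFunction :=
  stub_latticeEnd_of stub_latticeLaw stub_latticeDictionary stub_latticeChain stub_gsConfigLaw
    stub_latticeNoTouch

/-- **The crux follows from leg constancy along the Poisson-dilution leg** (the line's reduction theorem,
kernel-checked; both ends proved).  The hypothesis — the kernel in leg form — is an open universality statement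
and is NOT asserted anywhere in the tree. [folklore] -/
theorem squareFromVoronoiHub_of_dilutionLegConstancy
    (hK : ∀ R : ConformalRectangle, ∀ ε > (0 : ℝ), ∀ᶠ δ in 𝓝[>] (0 : ℝ),
      ∀ (t t' : unitInterval) (PB PW PB' PW' : Measure (PointConfig ℂ)),
        IsPoissonPointProcess (ENNReal.ofReal (t : ℝ) • (volume : Measure ℂ)) PB →
        IsPoissonPointProcess (ENNReal.ofReal (t : ℝ) • (volume : Measure ℂ)) PW →
        IsPoissonPointProcess (ENNReal.ofReal (t' : ℝ) • (volume : Measure ℂ)) PB' →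
        IsPoissonPointProcess (ENNReal.ofReal (t' : ℝ) • (volume : Measure ℂ)) PW' →
          |legProb t PB PW R δ - legProb t' PB' PW' R δ| ≤ ε) :
    Summit.CriticalPhenomena.CardyFormulaZ2.Theses.CardyFlipRusso.SquareFromVoronoiHub :=
  squareFromVoronoiHub_of_dilutionLeg stub_dilutionHypothesisEnd hK latticeEnd_holds

/-- **Registered reduction `stub_dilutionAssembly`**: leg constancy along the Poisson-dilution leg implies the
crux (the statement of `squareFromVoronoiHub_of_dilutionLegConstancy`). [folklore] -/
theorem stub_dilutionAssembly : (∀ R : ConformalRectangle, ∀ ε > (0 : ℝ), ∀ᶠ δ in 𝓝[>] (0 : ℝ),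
    ∀ (t t' : unitInterval) (PB PW PB' PW' : Measure (PointConfig ℂ)),
      IsPoissonPointProcess (ENNReal.ofReal (t : ℝ) • (volume : Measure ℂ)) PB →
      IsPoissonPointProcess (ENNReal.ofReal (t : ℝ) • (volume : Measure ℂ)) PW →
      IsPoissonPointProcess (ENNReal.ofReal (t' : ℝ) • (volume : Measure ℂ)) PB' →
      IsPoissonPointProcess (ENNReal.ofReal (t' : ℝ) • (volume : Measure ℂ)) PW' →
        |legProb t PB PW R δ - legProb t' PB' PW' R δ| ≤ ε) →
    Summit.CriticalPhenomena.CardyFormulaZ2.Theses.CardyFlipRusso.SquareFromVoronoiHub :=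
  fun hK => squareFromVoronoiHub_of_dilutionLegConstancy hK

end Summit.CriticalPhenomena.CardyFormulaZ2.Cruxes.SquareFromVoronoiHub.PoissonDilutionLeg

end
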